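import Summits.QuantumFields.YangMills.Theorems.UnitScaleTiltProp7DoubleCommutatorChain
import HarnessLib

/-!
# Route `UnitScaleTilt`, crux K1 «MinimiserStabilityRegPr» (stmt-QuantumFields-19200), route-R E′, S3 K-form engine, ROW (H) — hLap INHABITANT, FILE B (abstract letters):
# THE LAPLACIAN DEFECT OF A COMB LOCAL MODEL TO FIRST ORDER, EXACTLY — `2m − R(h₂⁻¹)m − R(h₁)m = −[Σ_k (C_k − C′_k), m] + (second order in commutator currency)`
# for two thin loops `h₁ = g(n)`, `h₂ = g′(n)` with the same rung structure, the first-order term LINEAR in the rung differences (so that the `μ`-sum of the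
# Laplacian can be regrouped INSIDE the commutator into currents)

Cell `ym3-torus`, width seat `ym3-torus-px4` (gen 4); ★ym-ust-19200-p1 g16 NAMER WORD 14 «px4 g4: hLap INHABITANT GO» (2026-08-29 00:17Z), road (iii) (★w4 g7 00:26Z) of this
seat's LOCATE-HLAP (19200 evidence #46).  THEOREMS ONLY (0 `def`, 0 `sorry`); `--supports stmt-QuantumFields-19200`, count-neutral.  YM₃ on T³ is a ladder rung (R3), not the
Clay problem; nothing here claims hLap, hRes, (H), S3, E′, a stub, the crux, d = 4 or the mass gap.

WHY.  ✓ `Prop7AxialLocalModel.lap_axialModel` gives `Δ_VΨ(x) = R(axialT⁻¹)·Σ_μ (2m − R(h(x−e_μ,μ))⁻¹m − R(h(x,μ))m)`.  ✓p682806 (FILE A) books `N_m(h₂⁻¹h₁)` with norms taken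
rung by rung.  For the k-uniform road (iii) the CURRENT must be formed BEFORE norms are taken: at a comb site `q` the rung differences of the strips of ALL directions `μ` with
`q` on a later leg add up to the covariant divergence of the curvature (the Yang–Mills current) — bookable by a criticality row — whereas each rung difference alone is only
bookable by two plaquette commutators (ℓ²-lossy, the LOCATE's Hardy count).  So this file expands the Laplacian defect DIRECTLY (no quotient loop): §1 the one-pair identity
`2m − R(h₂⁻¹)m − R(h₁)m = −[h₁ − h₂, m] − [h₁,m](h₁⁻¹ − 1) + (h₂⁻¹ − 1)[h₂,m]`; §2 the first-order extraction `[g(n) − g′(n), m] = [Σ_k (C_k − C′_k), m] + O(a·n)·(chain families)`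
(every remainder a product of a commutator and a small factor — never `‖m‖`); §3 the combination.  (The localisation of each rung difference to the bond-transported
neighbouring plaquette — the pair of ✓ `Prop7CurrentConjugationDefect` — is the companion file `…Prop7RungDifferenceLocal`.)

WHAT IS PROVED (ns `…Theorems.Prop7LapDefectFirstOrder`; `𝔸` a normed ring; chains `g(k+1) = (T k·P k·(T k)⁻¹)·g k` as in ✓ `Prop7CommutatorChain.comm_chain_le`).
* §1 `lapDefect_eq` (ring identity), ★ `norm_lapDefect_add_comm_le` (`‖(2m − R(h₂⁻¹)m − R(h₁)m) + [h₁ − h₂, m]‖ ≤ ‖h₁ − 1‖N_m(h₁) + ‖h₂ − 1‖N_m(h₂)`).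
* §2 `norm_chain_sub_one_le` (`‖g(n) − 1‖ ≤ Σ_(k<n)‖P_k − 1‖`), ★★ `comm_chain_sub_chain_sub_first_order_le` (`‖[g(n) − g′(n), m] − [Σ_(k<n)(C_k − C′_k), m]‖ ≤ 4a·n·(Σ_k N_k + Σ_k N′_k)`,
  `N_k = N_(R(T_k⁻¹)m)(P_k)`).
* §3 ★★★ `norm_lapDefect_chain_add_comm_sum_le` (`‖(2m − R(g′(n)⁻¹)m − R(g(n))m) + [Σ_(k<n)(C_k − C′_k), m]‖ ≤ 5a·n·(Σ_k N_k + Σ_k N′_k)`).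
HONEST SCOPE.  Pure normed-ring algebra; no lattice, no comb, no count; the localisation of the rung differences to the bond-transported neighbour (Jacobi) is the companion
file `…Prop7RungDifferenceLocal`; the identification of `Σ_μ` of the local terms with the current and the `Σ_h` telescoping of the non-current remainder come after.

References: T. Bałaban, CMP 98 (1985) 17–51 [Balaban1985Averaging] ((9) p.19, (19)–(20) p.21); CMP 99 (1985) 389–434 [Balaban1985BackgroundPropagators] ((3.3)–(3.4)
pp.390–391, (3.8)–(3.9) p.392); CMP 99 (1985) 75–102 [Balaban1985RegularSpaces] ((1.1)–(1.2) p.76, (1.9) p.77).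
-/

set_option autoImplicit false

noncomputable section

open scoped BigOperators

namespace Summit.QuantumFields.YangMills.Theorems.Prop7LapDefectFirstOrder

open Literature.MathematicalPhysics.QuantumFieldTheory.Balaban1983to89
open B9Eq39Adjoint (R R_def)
open Summit.QuantumFields.YangMills.Theorems.Prop7ConjFrameTransport (R_sub_self_eq_comm_mul R_inv_sub_self_eq_neg_mul_comm)
open Summit.QuantumFields.YangMills.Theorems.Prop7CommutatorChain (comm_chain_le comm_conj_le comm_inv_le comm_sub_one)
open Summit.QuantumFields.YangMills.Theorems.Prop7DoubleCommutatorChain (norm_conj_sub_one_le norm_rung_sub_rung_le norm_chain_sub_chain_le)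

variable {𝔸 : Type*} [NormedRing 𝔸]

/-! ## §1 One pair of loops: the Laplacian defect to first order -/

section Pair

/-- the ring identity: `2m − R(h₂⁻¹)m − R(h₁)m = −[h₁ − h₂, m] − [h₁,m](h₁⁻¹ − 1) + (h₂⁻¹ − 1)[h₂,m]` (✓ `R_sub_self_eq_comm_mul`, ✓ `R_inv_sub_self_eq_neg_mul_comm`). [folklore] -/
theorem lapDefect_eq (h₁ h₂ : 𝔸ˣ) (m : 𝔸) :
    (2 : ℕ) • m - R h₂⁻¹ m - R h₁ m
      = -(((h₁ : 𝔸) - (h₂ : 𝔸)) * m - m * ((h₁ : 𝔸) - (h₂ : 𝔸)))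
        - ((h₁ : 𝔸) * m - m * (h₁ : 𝔸)) * (((h₁⁻¹ : 𝔸ˣ) : 𝔸) - 1)
        + (((h₂⁻¹ : 𝔸ˣ) : 𝔸) - 1) * ((h₂ : 𝔸) * m - m * (h₂ : 𝔸)) := by
  have e1 : R h₁ m = m + ((h₁ : 𝔸) * m - m * (h₁ : 𝔸)) * ((h₁⁻¹ : 𝔸ˣ) : 𝔸) := by
    have := R_sub_self_eq_comm_mul h₁ m
    rw [← comm_sub_one] at this
    rw [← this]; abel
  have e2 : R h₂⁻¹ m = m - ((h₂⁻¹ : 𝔸ˣ) : 𝔸) * ((h₂ : 𝔸) * m - m * (h₂ : 𝔸)) := by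
    have := R_inv_sub_self_eq_neg_mul_comm h₂ m
    rw [← comm_sub_one] at this
    rw [sub_eq_add_neg m, ← this]; abel
  rw [e1, e2, two_nsmul]
  noncomm_ring

/-- ★ **THE LAPLACIAN DEFECT OF ONE PAIR TO FIRST ORDER**: for bi-contractive `h₁, h₂`,
`‖(2m − R(h₂⁻¹)m − R(h₁)m) + [h₁ − h₂, m]‖ ≤ ‖h₁ − 1‖·N_m(h₁) + ‖h₂ − 1‖·N_m(h₂)` — the first-order term is the commutator with the DIFFERENCE of the two loops, the remainder
is (loop size) × (loop commutator). [cite: Balaban1985BackgroundPropagators, (3.3)-(3.4) pp.390-391, (3.8) p.392] -/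
theorem norm_lapDefect_add_comm_le {h₁ h₂ : 𝔸ˣ} (hh₁ : ‖(h₁ : 𝔸)‖ ≤ 1 ∧ ‖((h₁⁻¹ : 𝔸ˣ) : 𝔸)‖ ≤ 1) (hh₂ : ‖(h₂ : 𝔸)‖ ≤ 1 ∧ ‖((h₂⁻¹ : 𝔸ˣ) : 𝔸)‖ ≤ 1) (m : 𝔸) :
    ‖((2 : ℕ) • m - R h₂⁻¹ m - R h₁ m) + (((h₁ : 𝔸) - (h₂ : 𝔸)) * m - m * ((h₁ : 𝔸) - (h₂ : 𝔸)))‖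
      ≤ ‖(h₁ : 𝔸) - 1‖ * ‖(h₁ : 𝔸) * m - m * (h₁ : 𝔸)‖ + ‖(h₂ : 𝔸) - 1‖ * ‖(h₂ : 𝔸) * m - m * (h₂ : 𝔸)‖ := by
  rw [lapDefect_eq]
  have e : -(((h₁ : 𝔸) - (h₂ : 𝔸)) * m - m * ((h₁ : 𝔸) - (h₂ : 𝔸)))
        - ((h₁ : 𝔸) * m - m * (h₁ : 𝔸)) * (((h₁⁻¹ : 𝔸ˣ) : 𝔸) - 1)
        + (((h₂⁻¹ : 𝔸ˣ) : 𝔸) - 1) * ((h₂ : 𝔸) * m - m * (h₂ : 𝔸))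
        + (((h₁ : 𝔸) - (h₂ : 𝔸)) * m - m * ((h₁ : 𝔸) - (h₂ : 𝔸)))
      = -(((h₁ : 𝔸) * m - m * (h₁ : 𝔸)) * (((h₁⁻¹ : 𝔸ˣ) : 𝔸) - 1)) + (((h₂⁻¹ : 𝔸ˣ) : 𝔸) - 1) * ((h₂ : 𝔸) * m - m * (h₂ : 𝔸)) := by
    abel
  rw [e]
  -- `‖h⁻¹ − 1‖ ≤ ‖h − 1‖` for `‖h⁻¹‖ ≤ 1` (`h⁻¹ − 1 = h⁻¹(1 − h)`; also ✓ `ShellMeasurePlaquetteCubicLocal.norm_inv_sub_one_le`, not imported here)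
  have hinv : ∀ {h : 𝔸ˣ}, ‖((h⁻¹ : 𝔸ˣ) : 𝔸)‖ ≤ 1 → ‖((h⁻¹ : 𝔸ˣ) : 𝔸) - 1‖ ≤ ‖(h : 𝔸) - 1‖ := fun {h} hh => by
    have e' : ((h⁻¹ : 𝔸ˣ) : 𝔸) - 1 = ((h⁻¹ : 𝔸ˣ) : 𝔸) * (1 - (h : 𝔸)) := by rw [mul_sub, mul_one, Units.inv_mul]
    rw [e', norm_sub_rev (h : 𝔸) 1]
    exact (norm_mul_le _ _).trans (by nlinarith [norm_nonneg (1 - (h : 𝔸))])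
  refine (norm_add_le _ _).trans (add_le_add ?_ ?_)
  · rw [norm_neg]
    refine (norm_mul_le _ _).trans ?_
    rw [mul_comm]
    exact mul_le_mul_of_nonneg_right (hinv hh₁.2) (norm_nonneg _)
  · exact (norm_mul_le _ _).trans (mul_le_mul_of_nonneg_right (hinv hh₂.2) (norm_nonneg _))

end Pair

/-! ## §2 Chains: the first-order extraction -/

section Chains

/-- `‖g(n) − 1‖ ≤ Σ_(k<n) ‖P_k − 1‖` for a chain of conjugated plaquettes with bi-contractive transports (`g(k+1) − 1 = C_k(g(k) − 1) + (C_k − 1)`, ✓ `norm_conj_sub_one_le`). [folklore] -/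
theorem norm_chain_sub_one_le (T P g : ℕ → 𝔸ˣ)
    (hT : ∀ k, ‖(T k : 𝔸)‖ ≤ 1 ∧ ‖(((T k)⁻¹ : 𝔸ˣ) : 𝔸)‖ ≤ 1) (hP : ∀ k, ‖(P k : 𝔸)‖ ≤ 1 ∧ ‖(((P k)⁻¹ : 𝔸ˣ) : 𝔸)‖ ≤ 1)
    (h0 : g 0 = 1) (hs : ∀ k, g (k + 1) = (T k * P k * (T k)⁻¹) * g k) :
    ∀ n : ℕ, ‖(g n : 𝔸) - 1‖ ≤ ∑ k ∈ Finset.range n, ‖(P k : 𝔸) - 1‖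
  | 0 => by rw [h0]; simp
  | n + 1 => by
    set C : 𝔸 := ((T n * P n * (T n)⁻¹ : 𝔸ˣ) : 𝔸) with hC
    have eg : ((g (n + 1) : 𝔸ˣ) : 𝔸) = C * (g n : 𝔸) := by rw [hC, ← Units.val_mul, ← hs n]
    have e : C * (g n : 𝔸) - 1 = C * ((g n : 𝔸) - 1) + (C - 1) := by noncomm_ring
    rw [Finset.sum_range_succ, eg, e]
    have hCn : ‖C‖ ≤ 1 := by
      rw [hC, Units.val_mul, Units.val_mul]
      calc ‖(T n : 𝔸) * (P n : 𝔸) * (((T n)⁻¹ : 𝔸ˣ) : 𝔸)‖ ≤ ‖(T n : 𝔸)‖ * ‖(P n : 𝔸)‖ * ‖(((T n)⁻¹ : 𝔸ˣ) : 𝔸)‖ :=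
            (norm_mul_le _ _).trans (mul_le_mul_of_nonneg_right (norm_mul_le _ _) (norm_nonneg _))
        _ ≤ 1 * 1 * 1 := mul_le_mul (mul_le_mul (hT n).1 (hP n).1 (norm_nonneg _) zero_le_one) (hT n).2 (norm_nonneg _) (by positivity)
        _ = 1 := by ring
    have ih := norm_chain_sub_one_le T P g hT hP h0 hs n
    have hC1 : ‖C - 1‖ ≤ ‖(P n : 𝔸) - 1‖ := by rw [hC]; exact norm_conj_sub_one_le (hT n) (P n)
    refine (norm_add_le _ _).trans (add_le_add ?_ hC1)
    exact (norm_mul_le _ _).trans (by nlinarith [norm_nonneg ((g n : 𝔸) - 1)])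

/-- ★★ **THE FIRST-ORDER EXTRACTION** (precise form): with `Δ_k = C_k − C′_k`, `N_k = N_(R(T_k⁻¹)m)(P_k)`, `N′_k` likewise, and plaquettes within `a ≥ 0` of `1`,
`‖[g(n) − g′(n), m] − [Σ_(k<n) Δ_k, m]‖ ≤ Σ_(j<n) (a·Σ_(k<j)(N_k + N′_k) + 2a·j·N_j + 2a·Σ_(k<j) N′_k + a·j·(N_j + N′_j))`
(step: `[C(X) + Δg′, m] − [ΣΔ + Δ, m] = C([X,m] − [ΣΔ,m]) + (C−1)[ΣΔ,m] + [C,m]X + Δ[g′,m] + [Δ,m](g′−1)` — every remainder is (small factor) × (commutator)).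
[cite: Balaban1985Averaging, (9) p.19, (19)-(20) p.21; Balaban1985BackgroundPropagators, (3.3)-(3.4) pp.390-391] -/
theorem comm_chain_sub_chain_sub_first_order_le_sum [NormOneClass 𝔸] (T P T' P' g g' : ℕ → 𝔸ˣ)
    (hT : ∀ k, ‖(T k : 𝔸)‖ ≤ 1 ∧ ‖(((T k)⁻¹ : 𝔸ˣ) : 𝔸)‖ ≤ 1) (hP : ∀ k, ‖(P k : 𝔸)‖ ≤ 1 ∧ ‖(((P k)⁻¹ : 𝔸ˣ) : 𝔸)‖ ≤ 1)
    (h0 : g 0 = 1) (hs : ∀ k, g (k + 1) = (T k * P k * (T k)⁻¹) * g k)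
    (hT' : ∀ k, ‖(T' k : 𝔸)‖ ≤ 1 ∧ ‖(((T' k)⁻¹ : 𝔸ˣ) : 𝔸)‖ ≤ 1) (hP' : ∀ k, ‖(P' k : 𝔸)‖ ≤ 1 ∧ ‖(((P' k)⁻¹ : 𝔸ˣ) : 𝔸)‖ ≤ 1)
    (hg' : ∀ k, ‖(g' k : 𝔸)‖ ≤ 1 ∧ ‖(((g' k)⁻¹ : 𝔸ˣ) : 𝔸)‖ ≤ 1) (h0' : g' 0 = 1) (hs' : ∀ k, g' (k + 1) = (T' k * P' k * (T' k)⁻¹) * g' k)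
    {a : ℝ} (ha : 0 ≤ a) (hPa : ∀ k, ‖(P k : 𝔸) - 1‖ ≤ a) (hP'a : ∀ k, ‖(P' k : 𝔸) - 1‖ ≤ a) (m : 𝔸) :
    ∀ n : ℕ, ‖(((g n : 𝔸) - (g' n : 𝔸)) * m - m * ((g n : 𝔸) - (g' n : 𝔸)))
        - ((∑ k ∈ Finset.range n, (((T k * P k * (T k)⁻¹ : 𝔸ˣ) : 𝔸) - ((T' k * P' k * (T' k)⁻¹ : 𝔸ˣ) : 𝔸))) * m
            - m * ∑ k ∈ Finset.range n, (((T k * P k * (T k)⁻¹ : 𝔸ˣ) : 𝔸) - ((T' k * P' k * (T' k)⁻¹ : 𝔸ˣ) : 𝔸)))‖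
      ≤ ∑ j ∈ Finset.range n, (a * ∑ k ∈ Finset.range j, (‖(P k : 𝔸) * R (T k)⁻¹ m - R (T k)⁻¹ m * (P k : 𝔸)‖ + ‖(P' k : 𝔸) * R (T' k)⁻¹ m - R (T' k)⁻¹ m * (P' k : 𝔸)‖)
          + 2 * a * j * ‖(P j : 𝔸) * R (T j)⁻¹ m - R (T j)⁻¹ m * (P j : 𝔸)‖
          + 2 * a * ∑ k ∈ Finset.range j, ‖(P' k : 𝔸) * R (T' k)⁻¹ m - R (T' k)⁻¹ m * (P' k : 𝔸)‖
          + a * j * (‖(P j : 𝔸) * R (T j)⁻¹ m - R (T j)⁻¹ m * (P j : 𝔸)‖ + ‖(P' j : 𝔸) * R (T' j)⁻¹ m - R (T' j)⁻¹ m * (P' j : 𝔸)‖))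
  | 0 => by rw [h0, h0']; simp
  | n + 1 => by
    set C : 𝔸 := ((T n * P n * (T n)⁻¹ : 𝔸ˣ) : 𝔸) with hC
    set C' : 𝔸 := ((T' n * P' n * (T' n)⁻¹ : 𝔸ˣ) : 𝔸) with hC'
    set N : ℕ → ℝ := fun k => ‖(P k : 𝔸) * R (T k)⁻¹ m - R (T k)⁻¹ m * (P k : 𝔸)‖ with hN
    set N' : ℕ → ℝ := fun k => ‖(P' k : 𝔸) * R (T' k)⁻¹ m - R (T' k)⁻¹ m * (P' k : 𝔸)‖ with hN'
    set S : 𝔸 := ∑ k ∈ Finset.range n, (((T k * P k * (T k)⁻¹ : 𝔸ˣ) : 𝔸) - ((T' k * P' k * (T' k)⁻¹ : 𝔸ˣ) : 𝔸)) with hS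
    set X : 𝔸 := (g n : 𝔸) - (g' n : 𝔸) with hX
    have eg : ((g (n + 1) : 𝔸ˣ) : 𝔸) = C * (g n : 𝔸) := by rw [hC, ← Units.val_mul, ← hs n]
    have eg' : ((g' (n + 1) : 𝔸ˣ) : 𝔸) = C' * (g' n : 𝔸) := by rw [hC', ← Units.val_mul, ← hs' n]
    rw [Finset.sum_range_succ, Finset.sum_range_succ, eg, eg']
    -- the five-term expansion
    have e : ((C * (g n : 𝔸) - C' * (g' n : 𝔸)) * m - m * (C * (g n : 𝔸) - C' * (g' n : 𝔸))) - ((S + (C - C')) * m - m * (S + (C - C')))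
        = C * ((X * m - m * X) - (S * m - m * S)) + (C - 1) * (S * m - m * S) + (C * m - m * C) * X
          + (C - C') * ((g' n : 𝔸) * m - m * (g' n : 𝔸)) + ((C - C') * m - m * (C - C')) * ((g' n : 𝔸) - 1) := by
      rw [hX]; noncomm_ring
    rw [e]
    -- sizes
    have hCn : ‖C‖ ≤ 1 := by
      rw [hC, Units.val_mul, Units.val_mul]
      calc ‖(T n : 𝔸) * (P n : 𝔸) * (((T n)⁻¹ : 𝔸ˣ) : 𝔸)‖ ≤ ‖(T n : 𝔸)‖ * ‖(P n : 𝔸)‖ * ‖(((T n)⁻¹ : 𝔸ˣ) : 𝔸)‖ :=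
            (norm_mul_le _ _).trans (mul_le_mul_of_nonneg_right (norm_mul_le _ _) (norm_nonneg _))
        _ ≤ 1 * 1 * 1 := mul_le_mul (mul_le_mul (hT n).1 (hP n).1 (norm_nonneg _) zero_le_one) (hT n).2 (norm_nonneg _) (by positivity)
        _ = 1 := by ring
    have hC1 : ‖C - 1‖ ≤ a := by rw [hC]; exact (norm_conj_sub_one_le (hT n) (P n)).trans (hPa n)
    have hCC' : ‖C - C'‖ ≤ 2 * a := by
      rw [hC, hC']; have := norm_rung_sub_rung_le (hT n) (hT' n) (P n) (P' n); linarith [hPa n, hP'a n]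
    have hNC : ‖C * m - m * C‖ ≤ N n := by rw [hC]; exact comm_conj_le (hT n) (P n) m
    have hNC' : ‖C' * m - m * C'‖ ≤ N' n := by rw [hC']; exact comm_conj_le (hT' n) (P' n) m
    have hND : ‖(C - C') * m - m * (C - C')‖ ≤ N n + N' n := by
      have ee : (C - C') * m - m * (C - C') = (C * m - m * C) - (C' * m - m * C') := by noncomm_ring
      rw [ee]; exact (norm_sub_le _ _).trans (add_le_add hNC hNC')
    have hXn : ‖X‖ ≤ 2 * a * n := by
      have h1 := norm_chain_sub_chain_le T P T' P' g g' hT hP h0 hs hg' h0' hs' n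
      have h2 : ∑ k ∈ Finset.range n, ‖((T k * P k * (T k)⁻¹ : 𝔸ˣ) : 𝔸) - ((T' k * P' k * (T' k)⁻¹ : 𝔸ˣ) : 𝔸)‖ ≤ ∑ k ∈ Finset.range n, 2 * a :=
        Finset.sum_le_sum fun k _ => by have := norm_rung_sub_rung_le (hT k) (hT' k) (P k) (P' k); linarith [hPa k, hP'a k]
      rw [Finset.sum_const, Finset.card_range, nsmul_eq_mul] at h2
      rw [hX]; linarith
    have hSm : ‖S * m - m * S‖ ≤ ∑ k ∈ Finset.range n, (N k + N' k) := by
      rw [hS, Finset.sum_mul, Finset.mul_sum, ← Finset.sum_sub_distrib]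
      refine (norm_sum_le _ _).trans (Finset.sum_le_sum fun k _ => ?_)
      have ee : (((T k * P k * (T k)⁻¹ : 𝔸ˣ) : 𝔸) - ((T' k * P' k * (T' k)⁻¹ : 𝔸ˣ) : 𝔸)) * m - m * (((T k * P k * (T k)⁻¹ : 𝔸ˣ) : 𝔸) - ((T' k * P' k * (T' k)⁻¹ : 𝔸ˣ) : 𝔸))
          = (((T k * P k * (T k)⁻¹ : 𝔸ˣ) : 𝔸) * m - m * ((T k * P k * (T k)⁻¹ : 𝔸ˣ) : 𝔸)) - (((T' k * P' k * (T' k)⁻¹ : 𝔸ˣ) : 𝔸) * m - m * ((T' k * P' k * (T' k)⁻¹ : 𝔸ˣ) : 𝔸)) := by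
        noncomm_ring
      rw [ee]; exact (norm_sub_le _ _).trans (add_le_add (comm_conj_le (hT k) (P k) m) (comm_conj_le (hT' k) (P' k) m))
    have hB : ‖(g' n : 𝔸) * m - m * (g' n : 𝔸)‖ ≤ ∑ k ∈ Finset.range n, N' k := comm_chain_le T' P' g' hT' hP' hg' h0' hs' m n
    have hg1 : ‖(g' n : 𝔸) - 1‖ ≤ a * n := by
      have h1 := norm_chain_sub_one_le T' P' g' hT' hP' h0' hs' n
      have h2 : ∑ k ∈ Finset.range n, ‖(P' k : 𝔸) - 1‖ ≤ ∑ k ∈ Finset.range n, a := Finset.sum_le_sum fun k _ => hP'a k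
      rw [Finset.sum_const, Finset.card_range, nsmul_eq_mul] at h2
      linarith
    have hN0 : ∀ k, 0 ≤ N k := fun k => norm_nonneg _
    have hN'0 : ∀ k, 0 ≤ N' k := fun k => norm_nonneg _
    have hSN0 : 0 ≤ ∑ k ∈ Finset.range n, (N k + N' k) := Finset.sum_nonneg fun k _ => add_nonneg (hN0 k) (hN'0 k)
    have hSN'0 : 0 ≤ ∑ k ∈ Finset.range n, N' k := Finset.sum_nonneg fun k _ => hN'0 k
    -- the induction hypothesis and the five bounds
    have ih := comm_chain_sub_chain_sub_first_order_le_sum T P T' P' g g' hT hP h0 hs hT' hP' hg' h0' hs' ha hPa hP'a m n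
    have t1 : ‖C * ((X * m - m * X) - (S * m - m * S))‖ ≤ ‖(X * m - m * X) - (S * m - m * S)‖ :=
      (norm_mul_le _ _).trans (by nlinarith [norm_nonneg ((X * m - m * X) - (S * m - m * S))])
    have t2 : ‖(C - 1) * (S * m - m * S)‖ ≤ a * ∑ k ∈ Finset.range n, (N k + N' k) :=
      (norm_mul_le _ _).trans (mul_le_mul hC1 hSm (norm_nonneg _) ha)
    have t3 : ‖(C * m - m * C) * X‖ ≤ 2 * a * n * N n := by
      refine (norm_mul_le _ _).trans ?_
      rw [mul_comm (2 * a * n)]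
      exact mul_le_mul hNC hXn (norm_nonneg _) (hN0 n)
    have t4 : ‖(C - C') * ((g' n : 𝔸) * m - m * (g' n : 𝔸))‖ ≤ 2 * a * ∑ k ∈ Finset.range n, N' k :=
      (norm_mul_le _ _).trans (mul_le_mul hCC' hB (norm_nonneg _) (by positivity))
    have t5 : ‖((C - C') * m - m * (C - C')) * ((g' n : 𝔸) - 1)‖ ≤ a * n * (N n + N' n) := by
      refine (norm_mul_le _ _).trans ?_
      rw [mul_comm (a * n)]
      exact mul_le_mul hND hg1 (norm_nonneg _) (add_nonneg (hN0 n) (hN'0 n))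
    have s := (norm_add_le _ _).trans (add_le_add ((norm_add_le _ _).trans (add_le_add ((norm_add_le _ _).trans (add_le_add
      ((norm_add_le _ _).trans (add_le_add t1 t2)) t3)) t4)) t5)
    refine s.trans ?_
    rw [hX, hS] at *
    linarith [ih]

/-- ★★ **THE FIRST-ORDER EXTRACTION** (crude form): `‖[g(n) − g′(n), m] − [Σ_(k<n) Δ_k, m]‖ ≤ 4a·n·(Σ_(k<n) N_k + Σ_(k<n) N′_k)`.
[cite: Balaban1985Averaging, (19)-(20) p.21; Balaban1985BackgroundPropagators, (3.3)-(3.4) pp.390-391] -/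
theorem comm_chain_sub_chain_sub_first_order_le [NormOneClass 𝔸] (T P T' P' g g' : ℕ → 𝔸ˣ)
    (hT : ∀ k, ‖(T k : 𝔸)‖ ≤ 1 ∧ ‖(((T k)⁻¹ : 𝔸ˣ) : 𝔸)‖ ≤ 1) (hP : ∀ k, ‖(P k : 𝔸)‖ ≤ 1 ∧ ‖(((P k)⁻¹ : 𝔸ˣ) : 𝔸)‖ ≤ 1)
    (h0 : g 0 = 1) (hs : ∀ k, g (k + 1) = (T k * P k * (T k)⁻¹) * g k)
    (hT' : ∀ k, ‖(T' k : 𝔸)‖ ≤ 1 ∧ ‖(((T' k)⁻¹ : 𝔸ˣ) : 𝔸)‖ ≤ 1) (hP' : ∀ k, ‖(P' k : 𝔸)‖ ≤ 1 ∧ ‖(((P' k)⁻¹ : 𝔸ˣ) : 𝔸)‖ ≤ 1)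
    (hg' : ∀ k, ‖(g' k : 𝔸)‖ ≤ 1 ∧ ‖(((g' k)⁻¹ : 𝔸ˣ) : 𝔸)‖ ≤ 1) (h0' : g' 0 = 1) (hs' : ∀ k, g' (k + 1) = (T' k * P' k * (T' k)⁻¹) * g' k)
    {a : ℝ} (ha : 0 ≤ a) (hPa : ∀ k, ‖(P k : 𝔸) - 1‖ ≤ a) (hP'a : ∀ k, ‖(P' k : 𝔸) - 1‖ ≤ a) (m : 𝔸) (n : ℕ) :
    ‖(((g n : 𝔸) - (g' n : 𝔸)) * m - m * ((g n : 𝔸) - (g' n : 𝔸)))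
        - ((∑ k ∈ Finset.range n, (((T k * P k * (T k)⁻¹ : 𝔸ˣ) : 𝔸) - ((T' k * P' k * (T' k)⁻¹ : 𝔸ˣ) : 𝔸))) * m
            - m * ∑ k ∈ Finset.range n, (((T k * P k * (T k)⁻¹ : 𝔸ˣ) : 𝔸) - ((T' k * P' k * (T' k)⁻¹ : 𝔸ˣ) : 𝔸)))‖
      ≤ 4 * a * n * (∑ k ∈ Finset.range n, ‖(P k : 𝔸) * R (T k)⁻¹ m - R (T k)⁻¹ m * (P k : 𝔸)‖
          + ∑ k ∈ Finset.range n, ‖(P' k : 𝔸) * R (T' k)⁻¹ m - R (T' k)⁻¹ m * (P' k : 𝔸)‖) := by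
  have main := comm_chain_sub_chain_sub_first_order_le_sum T P T' P' g g' hT hP h0 hs hT' hP' hg' h0' hs' ha hPa hP'a m n
  set N : ℕ → ℝ := fun k => ‖(P k : 𝔸) * R (T k)⁻¹ m - R (T k)⁻¹ m * (P k : 𝔸)‖ with hN
  set N' : ℕ → ℝ := fun k => ‖(P' k : 𝔸) * R (T' k)⁻¹ m - R (T' k)⁻¹ m * (P' k : 𝔸)‖ with hN'
  have hN0 : ∀ k, 0 ≤ N k := fun k => norm_nonneg _
  have hN'0 : ∀ k, 0 ≤ N' k := fun k => norm_nonneg _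
  refine main.trans ?_
  -- each summand `j < n` is at most `a·Σ(N+N′) + 2a·n·N_j + 2a·ΣN′ + a·n·(N_j + N′_j)`
  have step : ∀ j ∈ Finset.range n,
      a * ∑ k ∈ Finset.range j, (N k + N' k) + 2 * a * j * N j + 2 * a * ∑ k ∈ Finset.range j, N' k + a * j * (N j + N' j)
        ≤ a * ∑ k ∈ Finset.range n, (N k + N' k) + 2 * a * n * N j + 2 * a * ∑ k ∈ Finset.range n, N' k + a * n * (N j + N' j) := by
    intro j hj
    have hjn : j ≤ n := (Finset.mem_range.mp hj).le
    have hjr : (j : ℝ) ≤ n := by exact_mod_cast hjn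
    have s1 : ∑ k ∈ Finset.range j, (N k + N' k) ≤ ∑ k ∈ Finset.range n, (N k + N' k) :=
      Finset.sum_le_sum_of_subset_of_nonneg (Finset.range_mono hjn) fun k _ _ => add_nonneg (hN0 k) (hN'0 k)
    have s2 : ∑ k ∈ Finset.range j, N' k ≤ ∑ k ∈ Finset.range n, N' k :=
      Finset.sum_le_sum_of_subset_of_nonneg (Finset.range_mono hjn) fun k _ _ => hN'0 k
    have haj : a * j ≤ a * n := mul_le_mul_of_nonneg_left hjr ha
    have s3 : 2 * a * j * N j ≤ 2 * a * n * N j := mul_le_mul_of_nonneg_right (by linarith) (hN0 j)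
    have s4 : a * j * (N j + N' j) ≤ a * n * (N j + N' j) := mul_le_mul_of_nonneg_right haj (add_nonneg (hN0 j) (hN'0 j))
    have s1' : a * ∑ k ∈ Finset.range j, (N k + N' k) ≤ a * ∑ k ∈ Finset.range n, (N k + N' k) := mul_le_mul_of_nonneg_left s1 ha
    have s2' : 2 * a * ∑ k ∈ Finset.range j, N' k ≤ 2 * a * ∑ k ∈ Finset.range n, N' k := mul_le_mul_of_nonneg_left s2 (by positivity)
    linarith [s1', s2', s3, s4]
  refine (Finset.sum_le_sum step).trans (le_of_eq ?_)
  simp only [Finset.sum_add_distrib, Finset.sum_const, Finset.card_range, nsmul_eq_mul, ← Finset.mul_sum]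
  ring

end Chains

/-! ## §3 The Laplacian defect of a chain pair to first order -/

section LapChain

/-- ★★★ **THE LAPLACIAN DEFECT OF TWO PARALLEL THIN LOOPS TO FIRST ORDER, IN COMMUTATOR CURRENCY**: with `h₁ = g(n)`, `h₂ = g′(n)`, `Δ_k = T_kP_kT_k⁻¹ − T′_kP′_kT′_k⁻¹`,
`‖(2m − R(g′(n)⁻¹)m − R(g(n))m) + [Σ_(k<n) Δ_k, m]‖ ≤ 5a·n·(Σ_(k<n) N_(R(T_k⁻¹)m)(P_k) + Σ_(k<n) N_(R(T′_k⁻¹)m)(P′_k))` — i.e. the summand of ✓ `lap_axialModel` is MINUS the commutator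
of `m` with the SUM OF THE RUNG DIFFERENCES (linear — ready for regrouping over `μ`), up to `a·n` times the two single-ladder families.
[cite: Balaban1985BackgroundPropagators, (3.3)-(3.4) pp.390-391, (3.8) p.392; Balaban1985Averaging, (19)-(20) p.21] -/
theorem norm_lapDefect_chain_add_comm_sum_le [NormOneClass 𝔸] (T P T' P' g g' : ℕ → 𝔸ˣ)
    (hT : ∀ k, ‖(T k : 𝔸)‖ ≤ 1 ∧ ‖(((T k)⁻¹ : 𝔸ˣ) : 𝔸)‖ ≤ 1) (hP : ∀ k, ‖(P k : 𝔸)‖ ≤ 1 ∧ ‖(((P k)⁻¹ : 𝔸ˣ) : 𝔸)‖ ≤ 1)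
    (hg : ∀ k, ‖(g k : 𝔸)‖ ≤ 1 ∧ ‖(((g k)⁻¹ : 𝔸ˣ) : 𝔸)‖ ≤ 1) (h0 : g 0 = 1) (hs : ∀ k, g (k + 1) = (T k * P k * (T k)⁻¹) * g k)
    (hT' : ∀ k, ‖(T' k : 𝔸)‖ ≤ 1 ∧ ‖(((T' k)⁻¹ : 𝔸ˣ) : 𝔸)‖ ≤ 1) (hP' : ∀ k, ‖(P' k : 𝔸)‖ ≤ 1 ∧ ‖(((P' k)⁻¹ : 𝔸ˣ) : 𝔸)‖ ≤ 1)
    (hg' : ∀ k, ‖(g' k : 𝔸)‖ ≤ 1 ∧ ‖(((g' k)⁻¹ : 𝔸ˣ) : 𝔸)‖ ≤ 1) (h0' : g' 0 = 1) (hs' : ∀ k, g' (k + 1) = (T' k * P' k * (T' k)⁻¹) * g' k)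
    {a : ℝ} (ha : 0 ≤ a) (hPa : ∀ k, ‖(P k : 𝔸) - 1‖ ≤ a) (hP'a : ∀ k, ‖(P' k : 𝔸) - 1‖ ≤ a) (m : 𝔸) (n : ℕ) :
    ‖((2 : ℕ) • m - R (g' n)⁻¹ m - R (g n) m)
        + ((∑ k ∈ Finset.range n, (((T k * P k * (T k)⁻¹ : 𝔸ˣ) : 𝔸) - ((T' k * P' k * (T' k)⁻¹ : 𝔸ˣ) : 𝔸))) * m
            - m * ∑ k ∈ Finset.range n, (((T k * P k * (T k)⁻¹ : 𝔸ˣ) : 𝔸) - ((T' k * P' k * (T' k)⁻¹ : 𝔸ˣ) : 𝔸)))‖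
      ≤ 5 * a * n * (∑ k ∈ Finset.range n, ‖(P k : 𝔸) * R (T k)⁻¹ m - R (T k)⁻¹ m * (P k : 𝔸)‖
          + ∑ k ∈ Finset.range n, ‖(P' k : 𝔸) * R (T' k)⁻¹ m - R (T' k)⁻¹ m * (P' k : 𝔸)‖) := by
  set E : 𝔸 := (2 : ℕ) • m - R (g' n)⁻¹ m - R (g n) m with hE
  set D : 𝔸 := ((g n : 𝔸) - (g' n : 𝔸)) * m - m * ((g n : 𝔸) - (g' n : 𝔸)) with hD
  set Z : 𝔸 := (∑ k ∈ Finset.range n, (((T k * P k * (T k)⁻¹ : 𝔸ˣ) : 𝔸) - ((T' k * P' k * (T' k)⁻¹ : 𝔸ˣ) : 𝔸))) * m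
            - m * ∑ k ∈ Finset.range n, (((T k * P k * (T k)⁻¹ : 𝔸ˣ) : 𝔸) - ((T' k * P' k * (T' k)⁻¹ : 𝔸ˣ) : 𝔸)) with hZ
  set SN : ℝ := ∑ k ∈ Finset.range n, ‖(P k : 𝔸) * R (T k)⁻¹ m - R (T k)⁻¹ m * (P k : 𝔸)‖ with hSN
  set SN' : ℝ := ∑ k ∈ Finset.range n, ‖(P' k : 𝔸) * R (T' k)⁻¹ m - R (T' k)⁻¹ m * (P' k : 𝔸)‖ with hSN'
  have e : E + Z = (E + D) - (D - Z) := by abel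
  rw [e]
  have h1 : ‖E + D‖ ≤ ‖(g n : 𝔸) - 1‖ * ‖(g n : 𝔸) * m - m * (g n : 𝔸)‖ + ‖(g' n : 𝔸) - 1‖ * ‖(g' n : 𝔸) * m - m * (g' n : 𝔸)‖ := by
    rw [hE, hD]; exact norm_lapDefect_add_comm_le (hg n) (hg' n) m
  have h2 : ‖D - Z‖ ≤ 4 * a * n * (SN + SN') := by
    rw [hD, hZ, hSN, hSN']
    exact comm_chain_sub_chain_sub_first_order_le T P T' P' g g' hT hP h0 hs hT' hP' hg' h0' hs' ha hPa hP'a m n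
  -- sizes of the two loops and their commutators
  have hg1 : ‖(g n : 𝔸) - 1‖ ≤ a * n := by
    have := norm_chain_sub_one_le T P g hT hP h0 hs n
    have h' : ∑ k ∈ Finset.range n, ‖(P k : 𝔸) - 1‖ ≤ ∑ k ∈ Finset.range n, a := Finset.sum_le_sum fun k _ => hPa k
    rw [Finset.sum_const, Finset.card_range, nsmul_eq_mul] at h'
    linarith
  have hg'1 : ‖(g' n : 𝔸) - 1‖ ≤ a * n := by
    have := norm_chain_sub_one_le T' P' g' hT' hP' h0' hs' n
    have h' : ∑ k ∈ Finset.range n, ‖(P' k : 𝔸) - 1‖ ≤ ∑ k ∈ Finset.range n, a := Finset.sum_le_sum fun k _ => hP'a k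
    rw [Finset.sum_const, Finset.card_range, nsmul_eq_mul] at h'
    linarith
  have hN : ‖(g n : 𝔸) * m - m * (g n : 𝔸)‖ ≤ SN := comm_chain_le T P g hT hP hg h0 hs m n
  have hN' : ‖(g' n : 𝔸) * m - m * (g' n : 𝔸)‖ ≤ SN' := comm_chain_le T' P' g' hT' hP' hg' h0' hs' m n
  have hSN0 : 0 ≤ SN := Finset.sum_nonneg fun k _ => norm_nonneg _
  have hSN'0 : 0 ≤ SN' := Finset.sum_nonneg fun k _ => norm_nonneg _
  have han : 0 ≤ a * n := by positivity
  have h1' : ‖E + D‖ ≤ a * n * SN + a * n * SN' :=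
    h1.trans (add_le_add (mul_le_mul hg1 hN (norm_nonneg _) han) (mul_le_mul hg'1 hN' (norm_nonneg _) han))
  calc ‖(E + D) - (D - Z)‖ ≤ ‖E + D‖ + ‖D - Z‖ := norm_sub_le _ _
    _ ≤ (a * n * SN + a * n * SN') + 4 * a * n * (SN + SN') := add_le_add h1' h2
    _ = 5 * a * n * (SN + SN') := by ring

end LapChain

end Summit.QuantumFields.YangMills.Theorems.Prop7LapDefectFirstOrder

end
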